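import Mathlib.NumberTheory.Padics.Complex
import Mathlib.NumberTheory.Padics.PadicIntegers
import Mathlib.RingTheory.Norm.Transitivity
import Mathlib.RingTheory.AdjoinRoot
import Mathlib.FieldTheory.IntermediateField.Adjoin.Basic
import HarnessLib

/-!
# Field norms versus `p`-adic absolute values: `‖N_{K/ℚ_p}(z)‖ = ‖ι z‖^{[K:ℚ_p]}`, and the norm of
# `ℤ_p[X]/(Q)` base-changes to the norm of `ℚ_p[X]/(Q)` (proofs file)

Topic `NumberTheory/EllipticCurves` (sibling of `PadicIntLatticeIndexProofs`: step 2 of the VALUES LINK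
`#(Λ ⧸ (Q, g)) = ‖g(x)‖^{-deg Q}` for the index-currency specialisation principle). THEOREMS ONLY (no definition, no
named fact, no `sorry`).
* `PadicAlgCl.norm_algebraNorm_eq_norm_pow_finrank` — for a finite extension `K/ℚ_p` and ANY `ℚ_p`-embedding
  `ι : K →ₐ ℚ̄_p = PadicAlgCl p`: `‖N_{K/ℚ_p}(z)‖ = ‖ι z‖ ^ [K : ℚ_p]` (the norm on `ℚ̄_p` is the spectral norm,
  `‖y‖ = ‖a₀(y)‖^{1/deg}` with `a₀` the constant coefficient of the minimal polynomial —
  Mathlib `spectralNorm_eq_norm_coeff_zero_rpow` — and `N_{K/ℚ_p}(z) = N_{ℚ_p(z)/ℚ_p}(z)^{[K:ℚ_p(z)]} = (± a₀(z))^{[K:ℚ_p(z)]}`).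
* `PadicInt.algebraMap_norm_adjoinRoot_mk` — for a monic `Q ∈ ℤ_p[X]` and `r ∈ ℤ_p[X]`:
  `N_{(ℤ_p[X]/Q)/ℤ_p}(r̄) = N_{(ℚ_p[X]/Q)/ℚ_p}(r̄)` in `ℚ_p` (both are the determinant of the same matrix: multiplication
  by `r` in the power basis `1, x, …, x^{d-1}`, computed by reduction `mod Q`, which commutes with base change).
Written by the lead seat of line `birth` on crux K1 stmt-BirchSwinnertonDyer-24198 (research child A = stmt-26896).
HONEST FRAMING: field theory / linear algebra; nothing arithmetic; BSD is not proved by any of this.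

References: [Washington1997] §13.3; [NeukirchSchmidtWingberg2008] Ch. II §5 / Neukirch ANT II (4.8) (the unique extension
of `|·|_p` is `|N_{K/ℚ_p}(·)|^{1/n}`); [AtiyahMacdonald1969] Ch. 5 (norms and integrality).
-/

set_option autoImplicit false

noncomputable section

open scoped Classical Polynomial
open Module Polynomial

namespace Literature.NumberTheory.EllipticCurves

/-! ### §1 `‖N_{K/ℚ_p}(z)‖ = ‖ι z‖ ^ [K : ℚ_p]` -/

namespace PadicAlgCl

variable {p : ℕ} [Fact p.Prime]

/-- On `ℚ̄_p` the absolute value of an element is `‖a₀‖^{1/n}`, `a₀` the constant coefficient and `n` the degree of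
its minimal polynomial over `ℚ_p`; equivalently `‖a₀‖ = ‖y‖^n`. [cite: NeukirchSchmidtWingberg2008, Ch. II §5 (unique extension of the absolute value)] -/
theorem norm_coeff_zero_minpoly_eq (y : PadicAlgCl p) :
    ‖(minpoly ℚ_[p] y).coeff 0‖ = ‖y‖ ^ (minpoly ℚ_[p] y).natDegree := by
  have hn : 0 < (minpoly ℚ_[p] y).natDegree := minpoly.natDegree_pos (Algebra.IsIntegral.isIntegral y)
  have h := spectralNorm.spectralNorm_eq_norm_coeff_zero_rpow (K := ℚ_[p]) (L := PadicAlgCl p) y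
  rw [_root_.PadicAlgCl.spectralNorm_eq] at h
  -- `‖y‖ = ‖a₀‖ ^ (1/n)` ⟹ `‖y‖ ^ n = ‖a₀‖`
  have h2 : ‖y‖ ^ ((minpoly ℚ_[p] y).natDegree : ℝ) = ‖(minpoly ℚ_[p] y).coeff 0‖ := by
    rw [h, ← Real.rpow_mul (norm_nonneg _), one_div_mul_cancel (Nat.cast_pos.mpr hn).ne', Real.rpow_one]
  rw [← h2, Real.rpow_natCast]

/-- **`‖N_{K/ℚ_p}(z)‖ = ‖ι z‖ ^ [K : ℚ_p]`** for a finite extension `K` of `ℚ_p` and any `ℚ_p`-algebra embedding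
`ι : K → ℚ̄_p`: `N_{K/ℚ_p}(z) = N_{ℚ_p(z)/ℚ_p}(z)^{[K : ℚ_p(z)]} = (± a₀(z))^{[K : ℚ_p(z)]}` and `‖a₀(z)‖ = ‖ι z‖^{deg}`.
[cite: NeukirchSchmidtWingberg2008, Ch. II §5] [cite: Washington1997, §13.3] -/
theorem norm_algebraNorm_eq_norm_pow_finrank {K : Type*} [Field K] [Algebra ℚ_[p] K]
    [FiniteDimensional ℚ_[p] K] (ι : K →ₐ[ℚ_[p]] PadicAlgCl p) (z : K) :
    ‖Algebra.norm ℚ_[p] z‖ = ‖ι z‖ ^ Module.finrank ℚ_[p] K := by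
  have hz : IsIntegral ℚ_[p] z := Algebra.IsIntegral.isIntegral z
  rw [Algebra.norm_eq_norm_adjoin ℚ_[p] z]
  -- the norm of the generator of `ℚ_p⟮z⟯`
  have hgen : Algebra.norm ℚ_[p] (IntermediateField.AdjoinSimple.gen ℚ_[p] z) =
      (-1) ^ (minpoly ℚ_[p] z).natDegree * (minpoly ℚ_[p] z).coeff 0 := by
    have h := Algebra.PowerBasis.norm_gen_eq_coeff_zero_minpoly (IntermediateField.adjoin.powerBasis hz)
    rwa [IntermediateField.adjoin.powerBasis_gen, IntermediateField.adjoin.powerBasis_dim,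
      IntermediateField.minpoly_gen] at h
  rw [hgen, norm_pow, norm_mul, norm_pow, norm_neg, norm_one, one_pow, one_mul]
  -- `‖a₀(z)‖ = ‖ι z‖ ^ deg`
  have hmin : minpoly ℚ_[p] (ι z) = minpoly ℚ_[p] z := minpoly.algHom_eq ι ι.injective z
  rw [← hmin, norm_coeff_zero_minpoly_eq, hmin, ← pow_mul, ← IntermediateField.adjoin.finrank hz,
    Module.finrank_mul_finrank]

end PadicAlgCl

/-! ### §2 The norm of `ℤ_p[X]/(Q)` base-changes to the norm of `ℚ_p[X]/(Q)` -/

namespace PadicInt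

variable {p : ℕ} [Fact p.Prime]

/-- **Base change of the norm along `ℤ_p → ℚ_p`** for the monogenic algebra `ℤ_p[X]/(Q)`, `Q` monic:
`N_{(ℤ_p[X]/Q)/ℤ_p}(r̄) = N_{(ℚ_p[X]/Q)/ℚ_p}(r̄)` in `ℚ_p`. Both sides are the determinant of multiplication by `r` in
the power basis `1, x, …, x^{d-1}`; its `(i, j)` entry is the `i`-th coefficient of `(r · X^j) mod Q`, and reduction
modulo the monic `Q` commutes with the coefficient map (`Polynomial.map_modByMonic`).
[cite: AtiyahMacdonald1969, Ch. 5 (Prop. 5.1 ff.: integrality and norms)] [cite: Washington1997, §13.3] -/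
theorem algebraMap_norm_adjoinRoot_mk {Q : ℤ_[p][X]} (hQ : Q.Monic) (r : ℤ_[p][X]) :
    algebraMap ℤ_[p] ℚ_[p] (Algebra.norm ℤ_[p] (AdjoinRoot.mk Q r)) =
      Algebra.norm ℚ_[p] (AdjoinRoot.mk (Q.map (algebraMap ℤ_[p] ℚ_[p])) (r.map (algebraMap ℤ_[p] ℚ_[p]))) := by
  set φ := algebraMap ℤ_[p] ℚ_[p] with hφ
  have hQ' : (Q.map φ).Monic := hQ.map φ
  have hdim : Q.natDegree = (Q.map φ).natDegree := (hQ.natDegree_map φ).symm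
  -- the power bases `1, x, …, x^{d-1}` (as `Basis (Fin (natDegree _))`)
  have hb : ∀ j : Fin Q.natDegree, AdjoinRoot.powerBasisAux' hQ j = AdjoinRoot.root Q ^ (j : ℕ) :=
    fun j => (AdjoinRoot.powerBasis' hQ).basis_eq_pow j
  have hb' : ∀ j : Fin (Q.map φ).natDegree,
      AdjoinRoot.powerBasisAux' hQ' j = AdjoinRoot.root (Q.map φ) ^ (j : ℕ) :=
    fun j => (AdjoinRoot.powerBasis' hQ').basis_eq_pow j
  rw [Algebra.norm_eq_matrix_det (AdjoinRoot.powerBasisAux' hQ),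
    Algebra.norm_eq_matrix_det (AdjoinRoot.powerBasisAux' hQ'), RingHom.map_det]
  -- reindex along `Fin (deg Q) ≃ Fin (deg Q.map)` and compare entries
  have key : φ.mapMatrix (Algebra.leftMulMatrix (AdjoinRoot.powerBasisAux' hQ) (AdjoinRoot.mk Q r)) =
      Matrix.reindex (finCongr hdim).symm (finCongr hdim).symm
        (Algebra.leftMulMatrix (AdjoinRoot.powerBasisAux' hQ') (AdjoinRoot.mk (Q.map φ) (r.map φ))) := by
    ext i j
    rw [RingHom.mapMatrix_apply, Matrix.map_apply, Matrix.reindex_apply, Matrix.submatrix_apply,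
      Equiv.symm_symm, finCongr_apply, finCongr_apply,
      Algebra.leftMulMatrix_eq_repr_mul, Algebra.leftMulMatrix_eq_repr_mul, hb, hb',
      AdjoinRoot.powerBasisAux'_repr_apply_to_fun, AdjoinRoot.powerBasisAux'_repr_apply_to_fun,
      Fin.val_cast, Fin.val_cast, ← AdjoinRoot.mk_X, ← AdjoinRoot.mk_X, ← map_pow, ← map_pow, ← map_mul,
      ← map_mul, AdjoinRoot.modByMonicHom_mk, AdjoinRoot.modByMonicHom_mk, ← Polynomial.map_X φ,
      ← Polynomial.map_pow, ← Polynomial.map_mul, ← Polynomial.map_modByMonic φ hQ, Polynomial.coeff_map]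
  rw [key, Matrix.det_reindex_self]

end PadicInt

end Literature.NumberTheory.EllipticCurves

end
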